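import Literature.MathematicalPhysics.QuantumFieldTheory.Balaban1983to89.B1Eq239Normalization
import Literature.MathematicalPhysics.QuantumFieldTheory.Balaban1983to89.B1Ineq351Proof

/-!
# `Balaban1983to89.B1Eq361Proof` — T. Bałaban, *(Higgs)₂,₃ quantum fields in a finite volume. I. A lower bound*,
Commun. Math. Phys. **85** (1982) 603–626 [Balaban1982Higgs1]: the generating function **`E(e′, λ′, B, ψ)`** of the second
display numbered (3.60) on p. 623 (the text's *"(3.61)"*) — TYPED at real couplings over the tree's renormalization
transformation `B1RT.rtOp` (2.4) and the perturbative sum `B1Sect3Statements.pertSum362` (3.36)/(3.62), in the style of the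
accepted typings of (3.35)/(3.64) (`B1Eq365Proof.genFn335`, `genFn364`); and the FIRST EQUALITY of that display —
`−log[T_{a,L}[T_{a,L,A^{(k)ε}}[exp(−S^{(k)})]]] = ½⟨B, Δ^{(k+1)}B⟩ − log[N∫dA′_k e^{−½⟨A′_k,(C^{(k)})⁻¹A′_k⟩}·T_{a,L,…}[…]]` —
PROVED schematically at `(e′, λ′) = (e, λ)` from the splitting (3.41) of the quadratic form (`B1Sect3Statements.Split311`,
kernel-checked for the tree's data by `B1Eq314Proof.split311_stepData`) via `B1Ineq351Proof.integral_gauss_translate`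

statement-level skeleton of published theorems with citation tags; proofs where landed; nothing here is a claim about the Yang–Mills mass gap

PDF held: `paper:balaban1982-cmp85-higgs23-i` (journal page = PDF page + 602); pp. 623–624 READ AS IMAGES on the x2 renders
`run/shared/lean/pub/pub-balaban/b2b-balaban-ref1/pages/1982-cmp85-higgs23-I/…-p021-x2.png`, `…-p022-x2.png`; (3.36) p. 618
`…-p016-x2.png`; (3.41)–(3.42) p. 619 `…-p017-x2.png`.

CITATION HEADER (lean-in-tree rule).  WHAT IS REPRODUCED — SKELETON row **B1.Eq3.60b–3.61** of reader r12
(`lit-balaban-r12/ROWS-B1-part2.md`: «DEF E(e′,λ′,B,ψ) = −log[T^{L^kε}_{a,L}[T^{L^kε}_{a,L,A^{(k)ε}}[exp(−S^{(k),L^kε}(A,φ))]]] =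
½⟨B,Δ^{(k+1),L^{k+1}ε}B⟩ − log[…T_{a,L,eB^{(k+1)ε}+e′A′^{(k)ε}}[exp[−Σ(1/α!β!)e′^αλ′^β(∂^{α+β}E_k/…)(e″,λ″,eB^{(k+1)ε}+e′A′^{(k)ε},φ)∣₀]]]
(p.624: "not well defined … we can give a sense … characteristic functions"); absent · integral expression (ill-defined as printed,
per the author)») = row **B1.Eq3.60** of reader r14 (`lit-balaban-r14/ROWS-B1.md`, same reading).  Verbatim, p. 623 [PDF 21]:
*"Finally we have to verify that the action S^{(k+1),L^{k+1}ε} is given by a formula corresponding to (3.36). At first let us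
write the action as a perturbative expansion of some integral expression defined by the action S^{(k),L^kε}. Let us introduce
the function E(e′, λ′, B, ψ) = −log[T^{L^kε}_{a,L}[T^{L^kε}_{a,L,A^{(k)ε}}[exp(−S^{(k),L^kε}(A, φ))]]] = ½⟨B, Δ^{(k+1),L^{k+1}ε}B⟩
− log[(a(L^{k+1}ε)^{d−2}/2π)^{(d/2)|T₁^{(k)}|} ∫dA′_k exp(−½⟨A′_k, (C^{(k),L^kε})⁻¹A′_k⟩)·T^{L^kε}_{a,L,eB^{(k+1)ε}+e′A′^{(k)ε}}
[exp[−Σ_{0≦α+β≦n} (1/(α!β!)) e′^αλ′^β (∂^{α+β}/∂e″^α∂λ″^β E_k(e″, λ″, eB^{(k+1)ε} + e′A′^{(k)ε}, φ))|_{e″=λ″=0}]]]. (3.60)"*;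
p. 624 [PDF 22]: *"More exactly the formula is not well defined because the expression in the exponent is a high order
polynomial in the fields φ, A_k, which is not necessarily positive. We can give a sense to this formula introducing the
corresponding characteristic functions or adding some positive polynomial in these fields of a sufficiently high order and
with a coefficient which will be put equal to 0 after the expansions. It is not interesting enough to make these remarks more
precise. Analyzing carefully the successive steps we get the following perturbative formula S^{(k+1),L^{k+1}ε}(B, ψ) =
Σ_{0≦α+β≦n̄} (1/(α!β!)) e^αλ^β (∂^{α+β}/∂e′^α∂λ′^β E(e′, λ′, B, ψ))|_{e′=λ′=0}. (3.62)"*; p. 618 [PDF 16]: *"S^{(k),L^kε}(A, φ) =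
½⟨A, Δ^{(k),L^kε}A⟩ + Σ_{0≦α+β≦n̄} (1/(α!β!)) e^αλ^β (∂^{α+β}/∂e′^α∂λ′^β E_k(e′, λ′, eA^{(k),ε}, φ))|_{e′=λ′=0}, (3.36)"*; p. 619
[PDF 17]: *"This translation has the form A = A′ + aL⁻²C^{(k)}Q*B (3.41) and it separates the quadratic form in the fields A, B
in the exponential function under the integral (3.38) into a sum of the forms ½⟨B, Δ^{(k+1),L}B⟩ + ½⟨A′, (C^{(k)})⁻¹A′⟩. In the
remaining part of the action the field A occurs only through the function A^{(k)} … A^{(k)} = … = A′^{(k)} + B^{(k+1)}. (3.42)"*.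

THE TYPING (schematic where the paper's objects are built elsewhere, CONCRETE in the transformation structure): `V` ↤ `ℝ^N`
(finite-dimensional real inner-product space with Borel Lebesgue measure, as in `B1RT`); `X` ↤ the sites of the k-th lattice
carrying the scalar field `φ : X → V` (integrated inside `rtOp`); `Y` ↤ the block sites carrying `ψ : Y → V`; `(ΩA, νA)` ↤ the
vector fluctuation field `A′_k` with the WEIGHTED Gaussian measure `(a(L^{k+1}ε)^{d−2}/2π)^{(d/2)|T₁^{(k)}|}·exp(−½⟨A′_k,
(C^{(k)})⁻¹A′_k⟩)dA′_k` of the display (any measure on any measurable space); `t₁ e′ a` ↤ the kernel (2.5) of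
`T^{L^kε}_{a,L,𝒜}` with `𝒜 = eB^{(k+1)ε} + e′A′^{(k)ε}` (depends on the coupling `e′` and on the point `a = A′_k`; `B` is fixed
and suppressed); `Ek e′ a φ : ℝ → ℝ → ℝ` ↤ `(e″, λ″) ↦ E_k(e″, λ″, 𝒜, φ)`, the k-th generating function (3.35) at the background
`𝒜`; `nbar` ↤ `n` (= `n̄`); `quadB` ↤ `⟨B, Δ^{(k+1),L^{k+1}ε}B⟩`.  For the first equality (§2): `E`-valued vector fields `A`
with a translation-invariant measure `μ` (↤ `dA`), block vector fields `B : U`; the one-step VECTOR transformation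
`T^{L^kε}_{a,L}` written as `N_T·∫dA exp(−g_T(A,B))·(·)` (`g_T` ↤ `½aL^{d−2}Σ_y|B(y) − (QA)(y)|²`, cf. (3.38)); the k-th action
split as in (3.36), `S^{(k)}(A,φ) = ½q_Δ(A) + P(A,φ)` (`q_Δ` ↤ `⟨A,Δ^{(k)}A⟩`, `P` ↤ the perturbative sum); the scalar kernel
`t A` ↤ `t_{a,L,A^{(k)}}` (depends on `A` through `A^{(k)}`); the splitting hypothesis `Split311 c C Q* (g_T + ½q_Δ) (½quadB) q_{A′}`
= the sentence after (3.41) (`c` ↤ `aL⁻²`, `C` ↤ `C^{(k)}`, `q_{A′}` ↤ `½⟨A′,(C^{(k)})⁻¹A′⟩`).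

WHAT THIS FILE PROVES (0 `sorry`, standard axioms; ONE `def` with a body = the typed row, no `Prop` fact):
* `genFn361` — **(3.61) typed**: `E(e′,λ′;ψ) = ½quadB − log ∫_{ΩA} T_{t₁(e′,a)}[φ ↦ exp(−pertSum362 (E_k(·,·,𝒜(e′,a),φ)) e′ λ′ n)](ψ) dνA(a)`;
  unfolding lemma `genFn361_eq`; (3.62) for it is `pertSum362 (genFn361 … ψ) e λ n̄` (r12's typed row B1.Eq3.62–3.63).
* `rtOp_exp_split` — with (3.36), `T_A[e^{−S^{(k)}(A,·)}] = e^{−½q_Δ(A)}·T_A[e^{−P(A,·)}]` (linearity `B1Eq239Normalization.rtOp_const_mul`).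
* **`eq361_first`** — the FIRST EQUALITY of the display at the physical couplings: `−log(N_T∫dA e^{−g_T(A,B)}T_A[e^{−S^{(k)}(A,·)}](ψ))
  = ½quadB(B) − log(N_T∫dA′ e^{−q_{A′}(A′)}T_{A′+cCQ*B}[e^{−P(A′+cCQ*B,·)}](ψ))` whenever the last argument of `log` is non-zero —
  translation (3.41) under `dA` (`integral_gauss_translate`) + `Real.log_mul`/`Real.log_exp`;
* `integral_gaussWeight` — the weighted fluctuation measure `νA = (N_T·e^{−q_{A′}})·dA′` as a `withDensity` measure;
* **`eq361_genFn`** — the same equality with the right-hand side literally `genFn361 (quadB B) νA … e λ` once (3.36) at level k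
  (`B1Sect3Statements.Eq336`, the induction hypothesis on the form of the action) identifies `P(A,φ)` with the perturbative sum of
  `E_k(·,·,eA^{(k)},φ)`; the background after translation is `e(A′ + cCQ*B)^{(k)} = eB^{(k+1)} + eA′^{(k)}` by (3.42)
  (`B1Eq333Decomposition.eq342`, `B1Eq349Proof`), i.e. the printed `eB^{(k+1)ε} + e′A′^{(k)ε}` at `e′ = e`.
HONEST SCOPE.  (i) As printed the first expression does not display its dependence on `(e′, λ′)`; the second expression DEFINES
it (the coupling in front of the fluctuation part `A′^{(k)}` of the background and the Taylor variables of `E_k` are promoted to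
`(e′, λ′)`), and the two agree at `(e′, λ′) = (e, λ)` — which is exactly what `eq361_first`/`eq361_genFn` kernel-check; the
promotion itself is the definition `genFn361`.  (ii) The `−log` is Lean's real logarithm of a real (Bochner) integral, total by
convention; the author's caveat (p. 624, quoted above) that the integrand need not be integrable is NOT resolved here — no
positivity or convergence is asserted; the equality theorems carry the non-vanishing of the argument of `log` as an explicit
hypothesis.  (iii) (3.62) ⇒ (3.63) (*"in (3.61) we can take a whole function E_k instead of its expansion until the order n̄"*)
is an `n̄`-jet statement under the integral sign and is not treated (rows B1.Eq3.62–3.65: `B1Sect3Statements.Step363`,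
`B1Step363Proof`, `B1Eq365Proof`).
Unit `lit-balaban-p14` gen 3 (Phase-2 proof seat p14, literature-prover-lit-balaban-p14-g3-0), HOME `run/shared/lean/pub/lit-balaban/`
(seat log `lit-balaban-p14/STATUS.md`).
-/

open scoped ENNReal
open _root_.MeasureTheory _root_.Real

namespace Literature.MathematicalPhysics.QuantumFieldTheory.Balaban1983to89.B1Eq361Proof

open Literature.MathematicalPhysics.QuantumFieldTheory.Balaban1983to89
open B1RT B1Sect3Statements B1Ineq351Proof B1Eq239Normalization

/-! ## §1 The generating function (3.61), typed over `B1RT.rtOp` and `pertSum362` -/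

section GenFn

variable {V : Type*} [NormedAddCommGroup V] [InnerProductSpace ℝ V] [FiniteDimensional ℝ V]
  [MeasurableSpace V] [BorelSpace V]
variable {X Y : Type*} [Fintype X]
variable {ΩA : Type*} [MeasurableSpace ΩA]

/-- **(3.61)** (= the second display numbered (3.60), p. 623 [PDF 21]; verbatim in the module docstring): the generating
function `E(e′, λ′, B, ψ) = ½⟨B, Δ^{(k+1),L^{k+1}ε}B⟩ − log[(Gaussian normalisation)∫dA′_k exp(−½⟨A′_k,(C^{(k)})⁻¹A′_k⟩)·
T^{L^kε}_{a,L,𝒜}[exp[−Σ_{0≦α+β≦n}(1/(α!β!))e′^αλ′^β(∂^{α+β}E_k/∂e″^α∂λ″^β)(e″,λ″,𝒜,φ)|_{e″=λ″=0}]]]`, `𝒜 = eB^{(k+1)ε} +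
e′A′^{(k)ε}` — TYPED at real couplings as `½quadB` minus the logarithm of the `νA`-average (`νA` ↤ the weighted Gaussian
fluctuation measure of `A′_k`) of the renormalization transformation `B1RT.rtOp` with the `(e′, a)`-dependent kernel
`t₁ e′ a` (↤ (2.5) `t^{L^kε}_{a,L,𝒜}`) applied to the density `φ ↦ exp(−pertSum362 (E_k(·,·,𝒜,φ)) e′ λ′ n)` (the
exponent = the perturbative sum (3.36)/(3.62) `B1Sect3Statements.pertSum362` of `Ek e′ a φ` ↤ `(e″,λ″) ↦ E_k(e″,λ″,𝒜,φ)`),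
evaluated at the block field `ψ`.  The `−log` is the real logarithm of a real integral exactly as printed (p. 624: *"the
formula is not well defined … It is not interesting enough to make these remarks more precise"*).
[cite: Balaban1982Higgs1, (3.60)–(3.61) p.623] -/
noncomputable def genFn361 (quadB : ℝ) (νA : Measure ΩA) (t₁ : ℝ → ΩA → (Y → V) → (X → V) → ℝ)
    (Ek : ℝ → ΩA → (X → V) → ℝ → ℝ → ℝ) (nbar : ℕ) (ψ : Y → V) (e' l' : ℝ) : ℝ :=
  1 / 2 * quadB
    - Real.log (∫ a, rtOp (t₁ e' a) (fun φ => Real.exp (-pertSum362 (Ek e' a φ) e' l' nbar)) ψ ∂νA)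

/-- Unfolding lemma (definitional). [cite: Balaban1982Higgs1, (3.60)–(3.61) p.623] -/
theorem genFn361_eq (quadB : ℝ) (νA : Measure ΩA) (t₁ : ℝ → ΩA → (Y → V) → (X → V) → ℝ)
    (Ek : ℝ → ΩA → (X → V) → ℝ → ℝ → ℝ) (nbar : ℕ) (ψ : Y → V) (e' l' : ℝ) :
    genFn361 quadB νA t₁ Ek nbar ψ e' l' = 1 / 2 * quadB
      - Real.log (∫ a, rtOp (t₁ e' a) (fun φ => Real.exp (-pertSum362 (Ek e' a φ) e' l' nbar)) ψ ∂νA) := rfl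

/-- With the action split as in (3.36), `S^{(k)}(A, φ) = ½q_Δ(A) + P(A, φ)`, the quadratic gauge term leaves the scalar
transformation: `T_A[exp(−S^{(k)}(A,·))](ψ) = exp(−½q_Δ(A))·T_A[exp(−P(A,·))](ψ)`. [cite: Balaban1982Higgs1, (3.36) p.618] -/
theorem rtOp_exp_split (t : (Y → V) → (X → V) → ℝ) (qΔ : ℝ) (P : (X → V) → ℝ) (ψ : Y → V) :
    rtOp t (fun φ => Real.exp (-(1 / 2 * qΔ + P φ))) ψ
      = Real.exp (-(1 / 2 * qΔ)) * rtOp t (fun φ => Real.exp (-P φ)) ψ := by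
  rw [← rtOp_const_mul]
  congr 1
  funext φ
  rw [neg_add, Real.exp_add]

end GenFn

/-! ## §2 The first equality of (3.60)/(3.61): the translation (3.41) in the vector transformation -/

section FirstEquality

variable {E U : Type*} [AddCommGroup E] [Module ℝ E] [AddCommGroup U] [Module ℝ U]
  [MeasurableSpace E] [MeasurableAdd E] (μ : Measure E) [μ.IsAddLeftInvariant]
variable {V : Type*} [NormedAddCommGroup V] [InnerProductSpace ℝ V] [FiniteDimensional ℝ V]
  [MeasurableSpace V] [BorelSpace V]
variable {X Y : Type*} [Fintype X]

/-- **The first equality of (3.60)/(3.61) p. 623**, schematically, at the physical couplings: for the vector transformation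
`T^{L^kε}_{a,L}[F](B) = N_T∫dA e^{−g_T(A,B)}F(A)`, the scalar transformation `T_{a,L,A^{(k)}} = rtOp (t A)` and the action
`S^{(k)}(A,φ) = ½q_Δ(A) + P(A,φ)` ((3.36)), IF the translation `A = A′ + cCQ*B` (3.41) separates `g_T(A,B) + ½q_Δ(A)` into
`½quadB(B) + q_{A′}(A′)` (`Split311`; *"it separates the quadratic form … into a sum of the forms ½⟨B, Δ^{(k+1),L}B⟩ +
½⟨A′, (C^{(k)})⁻¹A′⟩"*), THEN `−log T_{a,L}[T_{a,L,A^{(k)}}[e^{−S^{(k)}}]](B,ψ) = ½quadB(B) − log(N_T∫dA′ e^{−q_{A′}(A′)}·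
T_{a,L,(A′+cCQ*B)^{(k)}}[e^{−P(A′+cCQ*B,·)}](ψ))`, provided the argument of the last `log` is non-zero.
[cite: Balaban1982Higgs1, (3.60)–(3.61) p.623] -/
theorem eq361_first {c : ℝ} {C : E →ₗ[ℝ] E} {Qs : U →ₗ[ℝ] E} {gT : E → U → ℝ} {qΔ : E → ℝ} {quadB : U → ℝ}
    {qA' : E → ℝ} (hsplit : Split311 c C Qs (fun A B => gT A B + 1 / 2 * qΔ A) (fun B => 1 / 2 * quadB B) qA')
    (NT : ℝ) (t : E → (Y → V) → (X → V) → ℝ) {S P : E → (X → V) → ℝ} (hS : ∀ A φ, S A φ = 1 / 2 * qΔ A + P A φ)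
    (B : U) (ψ : Y → V)
    (hne : NT * ∫ A', Real.exp (-qA' A') * rtOp (t (transl310 c C Qs A' B))
      (fun φ => Real.exp (-P (transl310 c C Qs A' B) φ)) ψ ∂μ ≠ 0) :
    -Real.log (NT * ∫ A, Real.exp (-gT A B) * rtOp (t A) (fun φ => Real.exp (-S A φ)) ψ ∂μ)
      = 1 / 2 * quadB B - Real.log (NT * ∫ A', Real.exp (-qA' A') * rtOp (t (transl310 c C Qs A' B))
          (fun φ => Real.exp (-P (transl310 c C Qs A' B) φ)) ψ ∂μ) := by
  -- pointwise in `A`: split off `e^{−½q_Δ(A)}` from the scalar transformation and merge the two Gaussian factors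
  have hpt : ∀ A, Real.exp (-gT A B) * rtOp (t A) (fun φ => Real.exp (-S A φ)) ψ
      = Real.exp (-((fun A B => gT A B + 1 / 2 * qΔ A) A B)) * rtOp (t A) (fun φ => Real.exp (-P A φ)) ψ := by
    intro A
    have hSA : (fun φ => Real.exp (-S A φ)) = fun φ => Real.exp (-(1 / 2 * qΔ A + P A φ)) := by
      funext φ
      rw [hS A φ]
    rw [hSA, rtOp_exp_split, ← mul_assoc, ← Real.exp_add]
    congr 2
    ring
  have hint : ∫ A, Real.exp (-gT A B) * rtOp (t A) (fun φ => Real.exp (-S A φ)) ψ ∂μ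
      = ∫ A, Real.exp (-((fun A B => gT A B + 1 / 2 * qΔ A) A B))
          * rtOp (t A) (fun φ => Real.exp (-P A φ)) ψ ∂μ :=
    integral_congr_ae (Filter.Eventually.of_forall hpt)
  -- the translation (3.41) under `dA`
  have hgt := integral_gauss_translate μ hsplit B (fun A => rtOp (t A) (fun φ => Real.exp (-P A φ)) ψ)
  rw [hint, hgt, mul_left_comm, Real.log_mul (Real.exp_pos _).ne' hne, Real.log_exp]
  ring

omit [AddCommGroup E] [Module ℝ E] [MeasurableAdd E] [μ.IsAddLeftInvariant] in
/-- The weighted fluctuation measure of (3.61), `νA = N_T·exp(−q_{A′}(A′))·dA′` (normalisation constant times the Gaussian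
density against the translation-invariant `dA′`), realised as a `withDensity` measure: integrals against it are the weighted
`dA′`-integrals. [cite: Balaban1982Higgs1, (3.60)–(3.61) p.623] -/
theorem integral_gaussWeight {NT : ℝ} (hNT : 0 ≤ NT) {qA' : E → ℝ} (hqA' : Measurable qA') (g : E → ℝ) :
    ∫ A', g A' ∂(μ.withDensity fun A' => ENNReal.ofReal (NT * Real.exp (-qA' A')))
      = NT * ∫ A', Real.exp (-qA' A') * g A' ∂μ := by
  have hw : Measurable fun A' => NT * Real.exp (-qA' A') := (hqA'.neg.exp).const_mul NT
  have h1 : ∫ A', g A' ∂(μ.withDensity fun A' => ENNReal.ofReal (NT * Real.exp (-qA' A')))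
      = ∫ A', (NT * Real.exp (-qA' A')).toNNReal • g A' ∂μ :=
    integral_withDensity_eq_integral_smul hw.real_toNNReal g
  have h2 : (fun A' => (NT * Real.exp (-qA' A')).toNNReal • g A') = fun A' => NT * (Real.exp (-qA' A') * g A') := by
    funext A'
    rw [NNReal.smul_def, smul_eq_mul, Real.coe_toNNReal _ (mul_nonneg hNT (Real.exp_pos _).le), mul_assoc]
  rw [h1, h2, integral_const_mul]

/-- **(3.60)/(3.61) first equality, right-hand side literally the typed `genFn361` at `(e′, λ′) = (e, λ)`**: with the
induction hypothesis (3.36) on the FORM of the k-th action — `B1Sect3Statements.Eq336 (S^{(k)}(A,φ)) ⟨A,Δ^{(k)}A⟩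
(E_k(·,·,eA^{(k)},φ)) e λ n̄` for every `A, φ` — the splitting (3.41) and the weighted fluctuation measure `νA = N_T·e^{−q_{A′}}dA′`,
`−log T_{a,L}[T_{a,L,A^{(k)}}[e^{−S^{(k)}}]](B,ψ) = genFn361 ⟨B,ΔB⟩ νA (a ↦ t_{(a+cCQ*B)^{(k)}}) (a ↦ E_k(·,·,e(a+cCQ*B)^{(k)},·)) n̄ ψ e λ`
(the background `e(A′+cCQ*B)^{(k)} = eB^{(k+1)} + eA′^{(k)}` by (3.42) — the printed `eB^{(k+1)ε} + e′A′^{(k)ε}` at `e′ = e`),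
provided the argument of the logarithm is non-zero. [cite: Balaban1982Higgs1, (3.60)–(3.61) p.623; (3.36) p.618] -/
theorem eq361_genFn {c : ℝ} {C : E →ₗ[ℝ] E} {Qs : U →ₗ[ℝ] E} {gT : E → U → ℝ} {qΔ : E → ℝ} {quadB : U → ℝ}
    {qA' : E → ℝ} (hsplit : Split311 c C Qs (fun A B => gT A B + 1 / 2 * qΔ A) (fun B => 1 / 2 * quadB B) qA')
    (hqA' : Measurable qA') {NT : ℝ} (hNT : 0 ≤ NT) (t : E → (Y → V) → (X → V) → ℝ) {S : E → (X → V) → ℝ}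
    {EkA : E → (X → V) → ℝ → ℝ → ℝ} {e lam : ℝ} {nbar : ℕ} (h336 : ∀ A φ, Eq336 (S A φ) (qΔ A) (EkA A φ) e lam nbar)
    (B : U) (ψ : Y → V)
    (hne : NT * ∫ A', Real.exp (-qA' A') * rtOp (t (transl310 c C Qs A' B))
      (fun φ => Real.exp (-pertSum362 (EkA (transl310 c C Qs A' B) φ) e lam nbar)) ψ ∂μ ≠ 0) :
    -Real.log (NT * ∫ A, Real.exp (-gT A B) * rtOp (t A) (fun φ => Real.exp (-S A φ)) ψ ∂μ)
      = genFn361 (quadB B) (μ.withDensity fun A' => ENNReal.ofReal (NT * Real.exp (-qA' A')))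
          (fun _ A' => t (transl310 c C Qs A' B)) (fun _ A' φ => EkA (transl310 c C Qs A' B) φ) nbar ψ e lam := by
  rw [genFn361_eq, integral_gaussWeight μ hNT hqA']
  exact eq361_first μ hsplit NT t (P := fun A φ => pertSum362 (EkA A φ) e lam nbar) (fun A φ => h336 A φ) B ψ hne

end FirstEquality

end Literature.MathematicalPhysics.QuantumFieldTheory.Balaban1983to89.B1Eq361Proof
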